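import Summits.Schanuel.Schanuel.Theorems.RootDecomp1HCyclesCore

/-!
# RootDecomp1H — ROUND 11 «CYCLIC SPINE»: exponential `n`-cycles inhabit cell `(n, 1)` of the instrument at EVERY rank,
# lie off the tower hull by rigidity with budget `n − 2`, and carry the residual as Schanuel's own instance

lens-5 cell decomp-schanuel, generation 11; `--supports stmt-Schanuel-30564` (residual `BridgeTransverse`) and
`stmt-Schanuel-27287` (instrument `FinCS`).  Imports only the landed `RootDecomp1HCyclesCore` (census T10 part 1, 2026-08-30;
the two-variable elimination `mem_closure_of_pair`), hence `RootDecomp1HGauge` (p770410).  Round 10 (`RootDecomp1HCycles`,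
rank `3`) is the base of the spine; nothing of its pending parts 2–5 is imported or restated under the same name (this file
lives in its own namespace and is rank-generic throughout).

## The objects

An EXPONENTIAL `n`-CYCLE with rational parameters `(r, c)`, `r_j ≠ 0`, is a point `y ∈ ℂⁿ` (indices in `ℤ/n = Fin n`) with
`y_{j+1} = r_j · e^{y_j} + c_j`.  With `u_j = e^{y_j}`: `ℚ(y, e^y) = ℚ(u)` (`IsCycleN.adjoin_cycle_eq`), so `trdeg ℚ(y, e^y) ≤ n`
— every `ℚ`-free `n`-cycle sits exactly AT Schanuel's bound.  UNIT parameters: `r_j = ε_j = ±1`, `c_j ∈ {−1, 0, 1}`; REAL: `y ∈ ℝⁿ`.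
The SPINE cycle at rank `m + 1` (`εSp ≡ −1`, `cSp = (−1, …, −1, 0)`): `y_{j+1} = −e^{y_j} − 1` along the chain, `y_0 = −e^{y_m}`.

## What is proved (0 sorry; every hypothesis is named in its statement)

§2 RIGIDITY WITH BUDGET `n − 2` (pure algebra; `n ≥ 3`): along every non-zero `v ∈ span_ℚ y` of an `n`-cycle the whole
   configuration `(y, e^y)` is algebraic over `ℚ(v, e^v)` and `n − 2` further numbers (`rigid_cycleN : Rigid y (n − 2)`).
   Mechanism: `M v = Σ p_j y_j` (`p ∈ ℤⁿ ∖ 0`) makes `Σ_j p_{j+1} r_j u_j` AFFINE in `u` and `∏ u_j^{p_j} = (e^v)^M` a MONOMIAL;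
   the PAIR SELECTION (`pair_selection`: indices `e ≠ f` with either `p_{e+1} ≠ 0 = p_{f+1}, p_f ≠ 0` or `p_{e+1}, p_{f+1}, p_e,
   p_f, p_e + p_f ≠ 0` — support not full: step off the support; support full: among three cyclically consecutive entries two
   have non-zero sum) leaves, after spending the budget on the other `n − 2` exponentials, a linear + monomial system in TWO
   unknowns which `mem_closure_of_pair` (round 10) or a one-variable elimination solves (`cycleCoreN`).
§3 CLEARANCE WITHOUT SELF-ABSORPTION (hypothesis `SchanuelOn 𝓚` ⟺ the route's structural binders `ProductSchanuel ∧
   RelTowerSchanuel`): ANY `ℚ`-free tuple that is rigid with budget `s`, `s + 2 ≤ n`, meets the span of every `ℚ`-free tower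
   tuple trivially and lies OFF THE TOWER HULL (`not_inTowerHull_of_rigid`; round 8's `inf_towerSpan_eq_bot` needed
   `SelfAbsorbing`, which already fails for 4-cycles — `v = y_0 + y_2`).  Hence every `ℚ`-free `n`-cycle, `n ≥ 3`, is off the
   hull (`not_inTowerHull_cycleN_of_structural`) and never inside `𝓚` (`cycleN_not_subset_curveHull`).
§4 THE CELL `(n, 1)` (no hypothesis): a real unit `n`-cycle in the sup-ball `‖y‖ ≤ 4` with `Σ y_j ≠ 0` is PRESENTED AT SIZE 1
   — system `X_{j+1} − ε_j Y_j − c_j`; its exponential Jacobian is invertible iff the CYCLE PRODUCT `∏ ε_j e^{y_j} ≠ 1`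
   (`det_jacobian_gCycN_ne_zero`: a kernel vector obeys `w_{j+1} = ε_j e^{y_j} w_j`, so `(1 − ∏) ∏ w_j = 0` and a zero
   coordinate propagates by `cyclic_induction`) — hence NEAR-`c⋆`-OPTIMAL with `c⋆ = 1` and CONJUGATION-STABLE
   (`realUnitCycleN_mem_cell`): it inhabits cell `(n, 1)` of `FinCS = FinCSAt stdGauge` and satisfies the first two inline
   hypotheses of `BridgeTransverse = BridgeAt stdGauge`.
§5 THE TANGENT LEMMA (no hypothesis): under the cyclic substitution `X_j ↦ ε_{j−1} U_{j−1} + c_{j−1}`, `Y_j ↦ U_j`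
   (`cycSubstN : ℤ[X, Y] → ℤ[U]`) every integer polynomial with ZERO image has its gradient at `(y, e^y)` in the `n`-plane
   spanned by the gradients of the `n` cycle equations (`gradN_mem_of_cycSubstN_eq_zero`, Leibniz induction); so `n + 1`
   polynomials with zero image never have independent gradients, and «no transverse certificate of size `≤ N` at `y`» follows
   from SOURCE EXCLUSION «every size-`≤ N` polynomial whose image vanishes at `u` has zero image» (`no_certificate_of_srcExclN`).
§6 HEIGHTS (no hypothesis): `ℓ¹` on `MvPolynomial σ ℤ` is subadditive and submultiplicative; for unit parameters the image of a
   size-`≤ D` polynomial has `ℓ¹`-norm `≤ hBound n D = (D+1)^{2n} · D · 2^D` (`l1_cycSubstN_le_hBound`; `= 10⁶, 2.5·10⁷,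
   6.25·10⁸` at `D = 4`, `n = 3, 4, 5`), so the census's literal EUCLIDEAN certificate `EuclExclN (e^y) D H` («no non-zero
   `G ∈ ℤ[U]`, `deg G ≤ D`, `‖G‖₂ ≤ H`, vanishes at `u`», FLINT/fpLLL + exact Gram–Schmidt bound) with `H ≥ hBound n D` gives
   `SrcExclN` (`srcExclN_of_euclExclN`, via `‖·‖₂ ≤ ‖·‖₁`; the sup-norm form `ImgExclN` likewise).
§7 THE NODE: `node_closes` is the live `RootDecomp1H.closes` (rev 14) CALLED — no item added, split or restated.  `cell_nodeN`:
   at a certified real unit `n`-cycle (a) the LIVE INSTRUMENT instance `FinCSAt stdGauge (n, 1, y)` HOLDS (`stdGauge n 1 = 4`,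
   certificate `EuclExclN (e^y) 4 H`, `H ≥ hBound n 4`); (b) for `n ≥ 3`, under `h₃ h₄` and `ℚ`-freeness, `y` is in the residual's
   domain; (c) the RESIDUAL instance `BridgeAt stdGauge (n, 1, y)` reads EXACTLY «`LowerRanks n → ¬ CounterEx y`» = «Schanuel in
   ranks `< n` ⟹ `e^{y_0}, …, e^{y_{n−1}}` algebraically independent» (`bridge_cell_iff_of_euclExclN`, `counterEx_cycleN_iff`).
   `finCS_apply_cell` / `bridgeTransverse_apply_cell` check that these ARE the items' literal instances.
§8 INHABITATION (kernel, every rank): the return map `x ↦ −e^{iter m x}` of the spine cycle has a fixed point in `[−1, 0]`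
   (intermediate value theorem), giving a real unit `(m+1)`-cycle with coordinates in `[−2, 0]` and `Σ y_j < 0`
   (`exists_realUnitCycleN`); `cell_inhabitedN m` packages §4–§7 at it.

## What is NOT proved

Schanuel at any cycle; `ℚ`-freeness of any specific cycle (an open transcendence statement — certified numerically by the
census, evidence only); the residual `BridgeTransverse` on any cell (it is Schanuel's own instance there, §7 (c)); the external
certificates (requested: census K11 «CYCLES41», real unit 4-cycles, `EuclExclN (e^y) 4 H`, `H ≥ 2.5·10⁷`).  Rung 0.
-/

set_option linter.dupNamespace false

noncomputable section

namespace Summit.Schanuel.Schanuel.Theorems.RootDecomp1HSpine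

open Complex Set
open Literature.NumberTheory.Transcendental (exists_nsmul_mem_span_int mem_adjoin_of_mem_span_int SchanuelRank Khovanskii.ePD)
open Summit.Schanuel.Schanuel.Theses.RootDecomp1H (ProductSchanuel RelTowerSchanuel BridgeTransverse FinCS)
open Summit.Schanuel.Schanuel.Theorems.RootDecomp1HTowerCells (trdeg_adjoin_adjoin_eq trdeg_adjoin_union_le
  trdeg_adjoin_range_le)
open Summit.Schanuel.Schanuel.Theorems.RootDecomp1HCurveHull
open Summit.Schanuel.Schanuel.Theorems.RootDecomp1HClearance (LowerRanks CounterEx InTowerHull)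
open Summit.Schanuel.Schanuel.Theorems.RootDecomp1HWitness
open Summit.Schanuel.Schanuel.Theorems.RootDecomp1HGauge
open Summit.Schanuel.Schanuel.Theorems.RootDecomp1HCycles (ratCast_mem mem_closure_of_isAlgebraic_closure mem_closure_of_pair)

/-! ## 1. Exponential `n`-cycles -/

section cycles

variable {n : ℕ} [NeZero n]

/-- `y` is an EXPONENTIAL `n`-CYCLE with rational parameters `(r, c)`: `r_j ≠ 0` and `y_{j+1} = r_j e^{y_j} + c_j` (`j ∈ ℤ/n`). -/
def IsCycleN (r c : Fin n → ℚ) (y : Fin n → ℂ) : Prop :=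
  (∀ j, r j ≠ 0) ∧ ∀ j, y (j + 1) = r j * cexp (y j) + c j

namespace IsCycleN

variable {r c : Fin n → ℚ} {y : Fin n → ℂ}

/-- `(r j : ℂ) ≠ 0`. -/
theorem r_ne (h : IsCycleN r c y) (j : Fin n) : (r j : ℂ) ≠ 0 := Rat.cast_ne_zero.2 (h.1 j)

/-- `y (j + 1) = r j * cexp (y j) + c j`. -/
theorem succ_eq (h : IsCycleN r c y) (j : Fin n) : y (j + 1) = r j * cexp (y j) + c j := h.2 j

/-- `y j = r (j - 1) * cexp (y (j - 1)) + c (j - 1)`. -/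
theorem self_eq (h : IsCycleN r c y) (j : Fin n) : y j = r (j - 1) * cexp (y (j - 1)) + c (j - 1) := by
  have := h.succ_eq (j - 1); rwa [sub_add_cancel] at this

/-- `cexp (y j) = (y (j + 1) - c j) / r j`. -/
theorem exp_eq (h : IsCycleN r c y) (j : Fin n) : cexp (y j) = (y (j + 1) - c j) / r j := by
  rw [h.succ_eq j]; field_simp [h.r_ne j]; ring

/-- `ℚ(y, e^y) = ℚ(e^{y_0}, …, e^{y_{n-1}})`: every coordinate is affine in the previous exponential. -/
theorem adjoin_cycle_eq (h : IsCycleN r c y) :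
    IntermediateField.adjoin ℚ (range y ∪ range (cexp ∘ y)) = IntermediateField.adjoin ℚ (range (cexp ∘ y)) := by
  refine le_antisymm (IntermediateField.adjoin_le_iff.2 ?_) (IntermediateField.adjoin.mono ℚ _ _ subset_union_right)
  rintro w (⟨j, rfl⟩ | ⟨j, rfl⟩)
  · rw [h.self_eq j]
    exact add_mem (mul_mem (ratCast_mem _ _) (IntermediateField.subset_adjoin ℚ _ ⟨j - 1, rfl⟩)) (ratCast_mem _ _)
  · exact IntermediateField.subset_adjoin ℚ _ ⟨j, rfl⟩

end IsCycleN

end cycles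

/-! ## 2. Rigidity of `n`-cycles with budget `n − 2`: the PAIR SELECTION and the two-variable elimination -/

section pairs

variable {n : ℕ} [NeZero n]

/-- `(1 : Fin n) ≠ 0`. -/
theorem one_ne_zero_fin (hn : 2 ≤ n) : (1 : Fin n) ≠ 0 := by
  intro h
  have := congrArg Fin.val h
  rw [Fin.val_one', Fin.val_zero, Nat.mod_eq_of_lt (by omega)] at this
  exact one_ne_zero this

/-- `f - 1 ≠ f`. -/
theorem sub_one_ne (hn : 2 ≤ n) (f : Fin n) : f - 1 ≠ f := by
  rw [Ne, sub_eq_self]; exact one_ne_zero_fin hn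

open Fin.NatCast in
/-- CYCLIC INDUCTION on `ℤ/n`: a property stable under `j ↦ j + 1` that holds somewhere holds everywhere. -/
theorem cyclic_induction {P : Fin n → Prop} (hstep : ∀ f, P f → P (f + 1)) {f₀ : Fin n} (h₀ : P f₀) : ∀ j, P j := by
  have key : ∀ k : ℕ, P (f₀ + (k : Fin n)) := by
    intro k
    induction k with
    | zero => simpa using h₀
    | succ k ih => have := hstep _ ih; rwa [add_assoc, ← Nat.cast_succ] at this
  intro j
  have := key (j - f₀).val
  rwa [Fin.cast_val_eq_self, add_sub_cancel] at this

/-- Full support propagates around the cycle. -/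
theorem forall_ne_zero_of_step {p : Fin n → ℤ} (hstep : ∀ f, p f ≠ 0 → p (f + 1) ≠ 0) {f₀ : Fin n} (h₀ : p f₀ ≠ 0) :
    ∀ j, p j ≠ 0 :=
  cyclic_induction (P := fun j => p j ≠ 0) hstep h₀

/-- **PAIR SELECTION.**  For a non-zero integer vector `p` on `ℤ/n`, `n ≥ 3`, there are indices `e ≠ f` such that EITHER
`p_{e+1} ≠ 0`, `p_{f+1} = 0`, `p_f ≠ 0` (the «linear / monomial» configuration) OR `p_{e+1}, p_{f+1}, p_e, p_f ≠ 0` and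
`p_e + p_f ≠ 0` (the «pair» configuration).  (Support `S ≠ ℤ/n`: `S − 1 ≠ S`, take `f ∈ S ∖ (S − 1) − …`; support full: among
`p_0 + p_1`, `p_1 + p_2`, `p_0 + p_2` one is non-zero.) -/
theorem pair_selection (hn : 3 ≤ n) {p : Fin n → ℤ} (hp : ∃ j, p j ≠ 0) :
    ∃ e f : Fin n, e ≠ f ∧ ((p (e + 1) ≠ 0 ∧ p (f + 1) = 0 ∧ p f ≠ 0) ∨
      (p (e + 1) ≠ 0 ∧ p (f + 1) ≠ 0 ∧ p e ≠ 0 ∧ p f ≠ 0 ∧ p e + p f ≠ 0)) := by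
  by_cases hex : ∃ f, p f ≠ 0 ∧ p (f + 1) = 0
  · obtain ⟨f, hf, hf1⟩ := hex
    refine ⟨f - 1, f, sub_one_ne (by omega) f, Or.inl ⟨?_, hf1, hf⟩⟩
    rwa [sub_add_cancel]
  · push Not at hex
    obtain ⟨f₀, h₀⟩ := hp
    have hall := forall_ne_zero_of_step hex h₀
    set i0 : Fin n := ⟨0, by omega⟩
    set i1 : Fin n := ⟨1, by omega⟩
    set i2 : Fin n := ⟨2, by omega⟩
    have h01 : i0 ≠ i1 := by simp [i0, i1, Fin.ext_iff]
    have h12 : i1 ≠ i2 := by simp [i1, i2, Fin.ext_iff]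
    have h02 : i0 ≠ i2 := by simp [i0, i2, Fin.ext_iff]
    by_cases hs01 : p i0 + p i1 = 0
    · by_cases hs12 : p i1 + p i2 = 0
      · refine ⟨i0, i2, h02, Or.inr ⟨hall _, hall _, hall _, hall _, ?_⟩⟩
        intro h
        have : p i1 = 0 := by omega
        exact hall i1 this
      · exact ⟨i1, i2, h12, Or.inr ⟨hall _, hall _, hall _, hall _, hs12⟩⟩
    · exact ⟨i0, i1, h01, Or.inr ⟨hall _, hall _, hall _, hall _, hs01⟩⟩

end pairs

section core

variable {n : ℕ} [NeZero n] {r c : Fin n → ℚ} {y : Fin n → ℂ}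

/-- **THE CORE OF RIGIDITY FOR `n`-CYCLES.**  For every non-zero `v ∈ span_ℚ y` of an `n`-cycle (`n ≥ 3`) there is a PAIR of
indices `e ≠ f` such that over every field `K ∋ v, e^v` containing the `n − 2` exponentials `e^{y_j}`, `j ∉ {e, f}`, ALL the
exponentials `e^{y_j}` are algebraic.  (Write `M v = Σ p_j y_j`, `p ∈ ℤⁿ`; in the coordinates `u_j = e^{y_j}` this is ONE linear
identity `Σ p_{j+1} r_j u_j = A` and ONE monomial identity `Π u_j^{p_j} = e^{Mv}`; the pair selection leaves a non-degenerate
two-variable system, solved by `mem_closure_of_pair`.) -/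
theorem cycleCoreN (h : IsCycleN r c y) (hn : 3 ≤ n) {v : ℂ} (hv : v ∈ Submodule.span ℚ (range y)) (hv0 : v ≠ 0) :
    ∃ e f : Fin n, e ≠ f ∧ ∀ K : IntermediateField ℚ ℂ, v ∈ K → cexp v ∈ K →
      (∀ j, j ≠ e → j ≠ f → cexp (y j) ∈ K) → ∀ j, cexp (y j) ∈ algebraicClosure K ℂ := by
  classical
  obtain ⟨M, hM, hMv⟩ := exists_nsmul_mem_span_int y hv
  obtain ⟨p, hp⟩ := (Submodule.mem_span_range_iff_exists_fun ℤ).1 hMv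
  simp only [zsmul_eq_mul, Rat.smul_def, Rat.cast_natCast] at hp
  -- `hp : ∑ j, p j * y j = M * v`
  set u : Fin n → ℂ := fun j => cexp (y j) with hudef
  have hu : ∀ j, u j ≠ 0 := fun j => Complex.exp_ne_zero _
  have hM0 : (M : ℂ) ≠ 0 := Nat.cast_ne_zero.2 hM
  have hp_ne : ∃ j, p j ≠ 0 := by
    by_contra hall
    push Not at hall
    have : (M : ℂ) * v = 0 := by rw [← hp]; exact Finset.sum_eq_zero fun j _ => by rw [hall j]; simp
    exact hv0 ((mul_eq_zero.1 this).resolve_left hM0)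
  -- the LINEAR identity in the coordinates `u`
  set α : Fin n → ℂ := fun j => (p (j + 1) : ℂ) * r j with hαdef
  set A : ℂ := (M : ℂ) * v - ∑ j, (p (j + 1) : ℂ) * (c j : ℂ) with hAdef
  have hLin : ∑ j, α j * u j = A := by
    have hre : ∑ j, (p (j + 1) : ℂ) * y (j + 1) = ∑ j, (p j : ℂ) * y j :=
      Equiv.sum_comp (Equiv.addRight (1 : Fin n)) (fun j => (p j : ℂ) * y j)
    have hexp : ∑ j, (p (j + 1) : ℂ) * y (j + 1) = ∑ j, (α j * u j + (p (j + 1) : ℂ) * (c j : ℂ)) :=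
      Finset.sum_congr rfl fun j _ => by rw [h.succ_eq j]; simp only [hαdef, hudef]; ring
    rw [hAdef, ← hp, ← hre, hexp, Finset.sum_add_distrib]; ring
  -- the MONOMIAL identity
  have hMon : ∏ j, u j ^ (p j) = cexp v ^ M := by
    rw [← Complex.exp_nat_mul, ← hp, Complex.exp_sum]
    exact Finset.prod_congr rfl fun j _ => by rw [Complex.exp_int_mul]
  have hαK : ∀ (K : IntermediateField ℚ ℂ) j, α j ∈ K := fun K j => mul_mem (intCast_mem K _) (ratCast_mem K _)
  have hAK : ∀ K : IntermediateField ℚ ℂ, v ∈ K → A ∈ K := fun K hvK =>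
    sub_mem (mul_mem (natCast_mem K M) hvK) (sum_mem fun j _ => mul_mem (intCast_mem K _) (ratCast_mem K _))
  have hα_ne : ∀ j, p (j + 1) ≠ 0 → α j ≠ 0 := fun j hj => mul_ne_zero (Int.cast_ne_zero.2 hj) (h.r_ne j)
  have hα_eq : ∀ j, p (j + 1) = 0 → α j = 0 := fun j hj => by simp [hαdef, hj]
  -- the pair
  obtain ⟨e, f, hef, hcase⟩ := pair_selection hn hp_ne
  refine ⟨e, f, hef, fun K hvK hevK hrest => ?_⟩
  -- split the sum and the product off the pair
  set s : Finset (Fin n) := (Finset.univ.erase e).erase f with hsdef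
  have hfs : f ∈ Finset.univ.erase e := Finset.mem_erase.2 ⟨hef.symm, Finset.mem_univ f⟩
  have hmem_s : ∀ j ∈ s, j ≠ e ∧ j ≠ f := fun j hj => by
    simp only [hsdef, Finset.mem_erase] at hj; exact ⟨hj.2.1, hj.1⟩
  have hsum : ∑ j, α j * u j = α e * u e + (α f * u f + ∑ j ∈ s, α j * u j) := by
    rw [← Finset.add_sum_erase _ _ (Finset.mem_univ e), ← Finset.add_sum_erase _ _ hfs]
  have hprod : ∏ j, u j ^ (p j) = u e ^ (p e) * (u f ^ (p f) * ∏ j ∈ s, u j ^ (p j)) := by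
    rw [← Finset.mul_prod_erase _ _ (Finset.mem_univ e), ← Finset.mul_prod_erase _ _ hfs]
  set R₁ : ℂ := ∑ j ∈ s, α j * u j with hR₁def
  set R₂ : ℂ := ∏ j ∈ s, u j ^ (p j) with hR₂def
  have hR₁K : R₁ ∈ K := sum_mem fun j hj => mul_mem (hαK K j) (hrest j (hmem_s j hj).1 (hmem_s j hj).2)
  have hR₂K : R₂ ∈ K := prod_mem fun j hj => zpow_mem (hrest j (hmem_s j hj).1 (hmem_s j hj).2) _
  have hR₂0 : R₂ ≠ 0 := Finset.prod_ne_zero_iff.2 fun j _ => zpow_ne_zero _ (hu j)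
  have hlin' : α e * u e + α f * u f = A - R₁ := by rw [← hLin, hsum]; ring
  have hmon' : u e ^ (p e) * u f ^ (p f) = cexp v ^ M * R₂⁻¹ := by
    rw [← hMon, hprod]; field_simp
  have hA'L : A - R₁ ∈ algebraicClosure K ℂ := mem_closure_of_mem K (sub_mem (hAK K hvK) hR₁K)
  have hB'L : cexp v ^ M * R₂⁻¹ ∈ algebraicClosure K ℂ := mem_closure_of_mem K (mul_mem (pow_mem hevK M) (inv_mem hR₂K))
  -- solve the two-variable system
  have hpair : u e ∈ algebraicClosure K ℂ ∧ u f ∈ algebraicClosure K ℂ := by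
    rcases hcase with ⟨he1, hf1, hpf⟩ | ⟨he1, hf1, hpe, hpf, hsum0⟩
    · -- `u_e` is LINEAR, `u_f` from the MONOMIAL
      have hαe := hα_ne e he1
      rw [hα_eq f hf1, zero_mul, add_zero] at hlin'
      have hUe : u e ∈ algebraicClosure K ℂ := by
        have : u e = (A - R₁) / α e := by rw [← hlin']; field_simp
        rw [this]; exact div_mem hA'L (mem_closure_of_mem K (hαK K e))
      refine ⟨hUe, mem_closure_of_zpow_mem K hpf ?_⟩
      have : u f ^ (p f) = cexp v ^ M * R₂⁻¹ * (u e ^ (p e))⁻¹ := by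
        rw [← hmon']; field_simp [zpow_ne_zero _ (hu e)]
      rw [this]; exact mul_mem hB'L (inv_mem (zpow_mem hUe _))
    · exact mem_closure_of_pair K hpe hpf hsum0 (hα_ne e he1) (hα_ne f hf1) (hu e) (hu f)
        (mem_closure_of_mem K (hαK K e)) (mem_closure_of_mem K (hαK K f)) hA'L hB'L hlin' hmon'
  intro j
  by_cases hje : j = e
  · rw [hje]; exact hpair.1
  by_cases hjf : j = f
  · rw [hjf]; exact hpair.2
  exact mem_closure_of_mem K (hrest j hje hjf)

/-- Over a field as in `cycleCoreN`, the coordinates `y_j` are algebraic too. -/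
theorem mem_closure_of_exp_mem (h : IsCycleN r c y) (K : IntermediateField ℚ ℂ)
    (hu : ∀ j, cexp (y j) ∈ algebraicClosure K ℂ) (j : Fin n) : y j ∈ algebraicClosure K ℂ := by
  rw [h.self_eq j]
  exact add_mem (mul_mem (mem_closure_of_mem K (ratCast_mem K _)) (hu _)) (mem_closure_of_mem K (ratCast_mem K _))

/-- **AN `n`-CYCLE IS RIGID WITH BUDGET `n − 2`** (`n ≥ 3`). -/
theorem rigid_cycleN (h : IsCycleN r c y) (hn : 3 ≤ n) : Rigid y (n - 2) := by
  classical
  intro v hv hv0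
  obtain ⟨e, f, hef, hK⟩ := cycleCoreN h hn hv hv0
  set s : Finset (Fin n) := (Finset.univ.erase e).erase f with hsdef
  have hfs : f ∈ Finset.univ.erase e := Finset.mem_erase.2 ⟨hef.symm, Finset.mem_univ f⟩
  have hcard : s.card = n - 2 := by
    rw [hsdef, Finset.card_erase_of_mem hfs, Finset.card_erase_of_mem (Finset.mem_univ e), Finset.card_univ,
      Fintype.card_fin]
    omega
  refine ⟨fun i => cexp (y (s.orderEmbOfFin hcard i)), fun K hvK hevK hxK => ?_⟩
  have hrest : ∀ j, j ≠ e → j ≠ f → cexp (y j) ∈ K := by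
    intro j hje hjf
    have hj : j ∈ (s : Set (Fin n)) := by
      simp only [Finset.mem_coe, hsdef, Finset.mem_erase]; exact ⟨hjf, hje, Finset.mem_univ j⟩
    rw [← Finset.range_orderEmbOfFin s hcard] at hj
    obtain ⟨i, hi⟩ := hj
    rw [← hi]; exact hxK i
  have hu := hK K hvK hevK hrest
  rintro w (⟨j, rfl⟩ | ⟨j, rfl⟩)
  · exact mem_algebraicClosure_iff.1 (mem_closure_of_exp_mem h K hu j)
  · exact mem_algebraicClosure_iff.1 (hu j)

end core

end Summit.Schanuel.Schanuel.Theorems.RootDecomp1HSpine
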